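import Summits.SmoothPoincare4.Statement
import Literature.Topology.FourManifolds.HomotopySpheres
import Literature.Topology.FourManifolds.TwistedSpheres
import Literature.Topology.FourManifolds.CerfGammaFour

/-!
# Route SchoenfliesSplit — assembly v3 (SmoothPoincare4)

Target: `Summits/SmoothPoincare4/Theorems/SchoenfliesSplit/Assembly.lean`.

Bookkeeping step of route `SmoothPoincare4/SchoenfliesSplit` (planner-SmoothPoincare4-Survey-0),
sorry-free and using nothing beyond its quoted hypotheses:

* `schsplit_assembly_v3` settles stmt-SmoothPoincare4-0517: from
  (h₀) the sphere inclusion `S³ ↪ ℝ⁴` is a smooth embedding (named fact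
  `Literature.isSmoothEmbedding_sphereInclusion' 3`, needed to form `closedBallBoundaryData 3`),
  (h₁) Cerf's theorem `Γ₄ = 0` in twisted-sphere form — every twisted sphere `D⁴ ∪_φ D⁴` is
  diffeomorphic to the round `S⁴` (this hypothesis is verbatim the body of the named fact
  `Literature.Topology.FourManifolds.cerf_twistedSphere_four`, Cerf 1968 main theorem; Kervaire–Milnor 1963 §1), and
  (h₂) the route's head crux stmt-SmoothPoincare4-0516 — every homotopy 4-sphere is a twisted
  sphere —, conclude that every `S : Literature.HomotopySphere 4` is diffeomorphic to `S⁴`, the input of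
  the checked reduction stmt-SmoothPoincare4-0441.

Proof (planner's Sketch7a script, re-checked by grounder-ground-B-0 and grounder-ground-A-0 and this refuter):
package `S.carrier` with the gluing witness from (h₂) as a `Literature.TwistedSphere 3 φ` and apply (h₁).

The scoped notations `𝓡 n`, `≃ₘ⟮_,_⟯` are opened at top level (not inside the namespace) so that
declarations appended after `end` still parse.
-/

open scoped Manifold ContDiff
open ContinuousMap

namespace Literature.SPC4

/-- Settles stmt-SmoothPoincare4-0517 (assembly v3 of route SchoenfliesSplit):
(S³ ↪ ℝ⁴ smooth embedding) → (Cerf Γ₄ = 0: every twisted 4-sphere ≅ S⁴) →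
(every homotopy 4-sphere is a twisted sphere) → every homotopy 4-sphere is diffeomorphic to `S⁴`.
Pure packaging. [folklore] -/
theorem schsplit_assembly_v3 :
    Literature.Topology.FourManifolds.isSmoothEmbedding_sphereInclusion' 3 → (∀ [Fact (Literature.Topology.FourManifolds.isSmoothEmbedding_sphereInclusion' 3)] (φ : (Metric.sphere (0 : EuclideanSpace ℝ (Fin 4)) 1) ≃ₘ⟮𝓡 3, 𝓡 3⟯ (Metric.sphere (0 : EuclideanSpace ℝ (Fin 4)) 1)) (T : Literature.Topology.FourManifolds.TwistedSphere 3 φ), Nonempty (T.carrier ≃ₘ⟮𝓡 4, 𝓡 4⟯ Metric.sphere (0 : EuclideanSpace ℝ (Fin 5)) 1)) → (∀ [Fact (Literature.Topology.FourManifolds.isSmoothEmbedding_sphereInclusion' 3)] (S : Literature.Topology.FourManifolds.HomotopySphere 4), ∃ φ : (Metric.sphere (0 : EuclideanSpace ℝ (Fin 4)) 1) ≃ₘ⟮𝓡 3, 𝓡 3⟯ (Metric.sphere (0 : EuclideanSpace ℝ (Fin 4)) 1), Literature.Topology.FourManifolds.IsTwistedSphere 3 φ S.carrier) → (∀ S :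 Literature.Topology.FourManifolds.HomotopySphere 4, Nonempty (S.carrier ≃ₘ⟮𝓡 4, 𝓡 4⟯ Metric.sphere (0 : EuclideanSpace ℝ (Fin 5)) 1)) := by
  intro hE hC hT S
  haveI : Fact (Literature.Topology.FourManifolds.isSmoothEmbedding_sphereInclusion' 3) := ⟨hE⟩
  obtain ⟨φ, h⟩ := hT S
  exact hC φ { carrier := S.carrier, isTwistedSphere := h }

/-- The Cerf hypothesis of `schsplit_assembly_v3` is literally the named fact
`Literature.Topology.FourManifolds.cerf_twistedSphere_four`; this restates the assembly with the fact by name. [folklore] -/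
theorem schsplit_assembly_v3' (hE : Literature.Topology.FourManifolds.isSmoothEmbedding_sphereInclusion' 3)
    (hC : Literature.Topology.FourManifolds.cerf_twistedSphere_four)
    (hT : ∀ [Fact (Literature.Topology.FourManifolds.isSmoothEmbedding_sphereInclusion' 3)] (S : Literature.Topology.FourManifolds.HomotopySphere 4),
      ∃ φ : (Metric.sphere (0 : EuclideanSpace ℝ (Fin 4)) 1) ≃ₘ⟮𝓡 3, 𝓡 3⟯
        (Metric.sphere (0 : EuclideanSpace ℝ (Fin 4)) 1), Literature.Topology.FourManifolds.IsTwistedSphere 3 φ S.carrier)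
    (S : Literature.Topology.FourManifolds.HomotopySphere 4) :
    Nonempty (S.carrier ≃ₘ⟮𝓡 4, 𝓡 4⟯ Metric.sphere (0 : EuclideanSpace ℝ (Fin 5)) 1) :=
  schsplit_assembly_v3 hE hC hT S

end Literature.SPC4
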